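import Mathlib
import HarnessLib
import Summits.Langlands.Langlands.Theorems.SplitPrimeDescentLadder
import Summits.Langlands.Langlands.Theorems.SplitPrimeDescentLadderResidual
import Literature.NumberTheory.GaloisRepresentations.ArtinReciprocityCharacterProofs
import Literature.NumberTheory.GaloisRepresentations.AbsGaloisOuterConj
import Literature.NumberTheory.GaloisRepresentations.ArtinRestriction
import Literature.NumberTheory.Automorphic.StrongArtinGL2

/-!
# `SplitPrimeDescentLadder` v3 — D∞' `CofinalResidualDoor`, stub T2 `stub_twistModel`: PRELUDE (parts A/B/C + coefficient transport)

Census pre-cut (400-line lint) of lens-1 g35's `T2_twistModel.lean` (sha256 a90f32bba9d26e97…), source lines 34–315 verbatim: sections `Eigen`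
(Cayley–Hamilton for split 2×2 charpolys), `Icosa` (A₅ perfect ⇒ projective image survives restriction to a cyclic M), `Restrict`,
`Transport` (coefficient transport along a ring iso). The assembled statement `twistModel_holds` (with the verbatim clause defs
`FieldClauses` / `ThreeSplit` / `GaloisClauses`) is in `Theorems/SplitPrimeDescentLadderTwistModel.lean`, which imports this file.
Texts unchanged; only the file boundary and the linter option are census hygiene.
-/

set_option linter.dupNamespace false

namespace Summit.Langlands.Langlands.Theorems.SplitPrimeDescentLadder.V3Birth.CofinalResidualDoor


open Finset

/-- `‖(20 : \bar ℚ₃)‖ = 1`. [folklore] -/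
theorem norm_twenty_padicAlgCl_three : ‖(20 : PadicAlgCl 3)‖ = 1 := by
  have h : (20 : PadicAlgCl 3) = algebraMap ℚ_[3] (PadicAlgCl 3) ((20 : ℤ) : ℚ_[3]) := by
    rw [Int.cast_ofNat, map_ofNat]
  rw [h, norm_algebraMap']
  refine le_antisymm (Padic.norm_int_le_one _) ?_
  by_contra hlt
  have hdvd : ((3 : ℕ) : ℤ) ∣ (20 : ℤ) := Padic.norm_intCast_lt_one_iff.1 (lt_of_not_ge hlt)
  omega

/-- Norm of a root of unity is `1`. [folklore] -/
theorem norm_eq_one_of_pow_eq_one' {K : Type*} [NormedField K] {x : K} {n : ℕ} (hn : n ≠ 0)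
    (hx : x ^ n = 1) : ‖x‖ = 1 := by
  have h : ‖x‖ ^ n = 1 := by rw [← norm_pow, hx, norm_one]
  exact (pow_eq_one_iff_of_nonneg (norm_nonneg x) hn).1 h

/-- Ultrametric: `‖x ^ k - 1‖ ≤ ‖x - 1‖` when `‖x‖ ≤ 1`. [folklore] -/
theorem norm_pow_sub_one_le {K : Type*} [NormedField K] [IsUltrametricDist K] {x : K}
    (hx : ‖x‖ ≤ 1) (k : ℕ) : ‖x ^ k - 1‖ ≤ ‖x - 1‖ := by
  have hgeom : x ^ k - 1 = (∑ i ∈ range k, x ^ i) * (x - 1) := (geom_sum_mul x k).symm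
  rw [hgeom, norm_mul]
  have hS : ‖∑ i ∈ range k, x ^ i‖ ≤ 1 := by
    refine IsUltrametricDist.norm_sum_le_of_forall_le_of_nonneg zero_le_one fun i _ => ?_
    rw [norm_pow]; exact pow_le_one₀ (norm_nonneg x) hx
  calc ‖∑ i ∈ range k, x ^ i‖ * ‖x - 1‖ ≤ 1 * ‖x - 1‖ :=
        mul_le_mul_of_nonneg_right hS (norm_nonneg _)
    _ = ‖x - 1‖ := one_mul _

/-- In `\bar ℚ₃`: a `20`-th root of unity congruent to `1` is `1` (`‖20‖₃ = 1`). [folklore] -/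
theorem eq_one_of_pow_twenty_of_norm_sub_one_lt {u : PadicAlgCl 3} (hu : u ^ 20 = 1)
    (hlt : ‖u - 1‖ < 1) : u = 1 := by
  by_contra hne
  have hnorm : ‖u‖ = 1 := norm_eq_one_of_pow_eq_one' (by norm_num) hu
  -- the geometric sum vanishes
  have hS : (∑ i ∈ range 20, u ^ i) = 0 := by
    have h := geom_sum_mul u 20
    rw [hu, sub_self] at h
    exact (mul_eq_zero.1 h).resolve_right (sub_ne_zero.2 hne)
  -- but it is congruent to 20
  have hdiff : ‖(∑ i ∈ range 20, u ^ i) - 20‖ < 1 := by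
    have hrw : (∑ i ∈ range 20, u ^ i) - 20 = ∑ i ∈ range 20, (u ^ i - 1) := by
      rw [Finset.sum_sub_distrib, Finset.sum_const, Finset.card_range]; norm_num
    rw [hrw]
    refine lt_of_le_of_lt (IsUltrametricDist.norm_sum_le_of_forall_le_of_nonempty
      ⟨0, by simp⟩ fun i _ => norm_pow_sub_one_le hnorm.le i) hlt
  rw [hS, zero_sub, norm_neg, norm_twenty_padicAlgCl_three] at hdiff
  exact lt_irrefl _ hdiff

/-- **Key unit lemma.** `ζ ^ 60 = 1`, `ζ ≠ 1`, `ζ² + ζ + 1 ≠ 0` in `\bar ℚ₃` force `‖ζ - 1‖ = 1`: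
the prime-to-`3` part `ζ ^ 21` is `≡ 1`, hence `= 1`, so `ζ ^ 3 = 1`, contradiction. [folklore] -/
theorem norm_sub_one_eq_one_of_pow_sixty {ζ : PadicAlgCl 3} (h60 : ζ ^ 60 = 1) (h1 : ζ ≠ 1)
    (h3 : ζ ^ 2 + ζ + 1 ≠ 0) : ‖ζ - 1‖ = 1 := by
  have hnorm : ‖ζ‖ = 1 := norm_eq_one_of_pow_eq_one' (by norm_num) h60
  have hle : ‖ζ - 1‖ ≤ 1 := by
    rw [sub_eq_add_neg]
    refine (IsUltrametricDist.norm_add_le_max ζ (-1)).trans ?_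
    rw [norm_neg, norm_one, hnorm, max_self]
  refine le_antisymm hle (not_lt.1 fun hlt => ?_)
  have hu20 : (ζ ^ 21) ^ 20 = 1 := by
    rw [← pow_mul, show 21 * 20 = 60 * 7 by norm_num, pow_mul, h60, one_pow]
  have hu : ζ ^ 21 = 1 :=
    eq_one_of_pow_twenty_of_norm_sub_one_lt hu20 (lt_of_le_of_lt (norm_pow_sub_one_le hnorm.le 21) hlt)
  have hζ3 : ζ ^ 3 = 1 := by
    have h63 : ζ ^ 63 = 1 := by
      rw [show (63 : ℕ) = 21 * 3 by norm_num, pow_mul, hu, one_pow]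
    have : ζ ^ 60 * ζ ^ 3 = 1 := by rw [← pow_add]; exact h63
    simpa [h60] using this
  have hfac : (ζ - 1) * (ζ ^ 2 + ζ + 1) = 0 := by
    have : (ζ - 1) * (ζ ^ 2 + ζ + 1) = ζ ^ 3 - 1 := by ring
    rw [this, hζ3, sub_self]
  rcases mul_eq_zero.1 hfac with h | h
  · exact h1 (sub_eq_zero.1 h)
  · exact h3 h

/-- **Distinguishedness survives the `3`-adic transport**: roots of unity `a ≠ b` with `a ^ 60 = b ^ 60`
and `a² + ab + b² ≠ 0` satisfy `‖a - b‖₃ = 1`. [folklore] -/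
theorem norm_sub_eq_one_of_rootsOfUnity {a b : PadicAlgCl 3} {n : ℕ} (hn : n ≠ 0) (_ha : a ^ n = 1)
    (hb : b ^ n = 1) (h60 : a ^ 60 = b ^ 60) (hab : a ≠ b) (h3 : a ^ 2 + a * b + b ^ 2 ≠ 0) :
    ‖a - b‖ = 1 := by
  have hb0 : b ≠ 0 := fun h => by rw [h, zero_pow hn] at hb; exact zero_ne_one hb
  have hnb : ‖b‖ = 1 := norm_eq_one_of_pow_eq_one' hn hb
  set ζ := a * b⁻¹ with hζ
  have haζ : a = b * ζ := by rw [hζ]; field_simp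
  have hζ60 : ζ ^ 60 = 1 := by
    rw [hζ, mul_pow, h60, inv_pow, mul_inv_cancel₀ (pow_ne_zero _ hb0)]
  have hζ1 : ζ ≠ 1 := fun h => hab (by rw [haζ, h, mul_one])
  have hζ3 : ζ ^ 2 + ζ + 1 ≠ 0 := by
    intro h
    apply h3
    have : a ^ 2 + a * b + b ^ 2 = b ^ 2 * (ζ ^ 2 + ζ + 1) := by rw [haζ]; ring
    rw [this, h, mul_zero]
  have hsub : a - b = b * (ζ - 1) := by rw [haζ]; ring
  rw [hsub, norm_mul, hnb, one_mul, norm_sub_one_eq_one_of_pow_sixty hζ60 hζ1 hζ3]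



open Polynomial

section Eigen

variable {K : Type*} [Field K]

/-- Cayley–Hamilton for a split `2 × 2` characteristic polynomial: `A (A - b) = a (A - b)`. [folklore] -/
theorem mul_sub_smul_eq_smul {A : Matrix (Fin 2) (Fin 2) K} {a b : K}
    (h : A.charpoly = (X - C a) * (X - C b)) :
    A * (A - b • (1 : Matrix (Fin 2) (Fin 2) K)) = a • (A - b • (1 : Matrix (Fin 2) (Fin 2) K)) := by
  have hCH := Matrix.aeval_self_charpoly A
  rw [h, map_mul, map_sub, map_sub, aeval_X, aeval_C, aeval_C, Algebra.algebraMap_eq_smul_one,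
    Algebra.algebraMap_eq_smul_one, sub_mul, smul_mul_assoc, one_mul, sub_eq_zero] at hCH
  exact hCH

/-- `A ^ k (A - b) = a ^ k (A - b)`. [folklore] -/
theorem pow_mul_sub_smul_eq_smul {A : Matrix (Fin 2) (Fin 2) K} {a b : K}
    (h : A.charpoly = (X - C a) * (X - C b)) (k : ℕ) :
    A ^ k * (A - b • (1 : Matrix (Fin 2) (Fin 2) K)) = a ^ k • (A - b • (1 : Matrix (Fin 2) (Fin 2) K)) := by
  induction k with
  | zero => rw [pow_zero, pow_zero, one_mul, one_smul]
  | succ k ih => rw [pow_succ, mul_assoc, mul_sub_smul_eq_smul h, mul_smul_comm, ih, smul_smul, ← pow_succ']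

/-- `charpoly (b • 1) = (X - b)²` for `2 × 2` matrices. [folklore] -/
theorem charpoly_smul_one_fin_two (b : K) :
    (b • (1 : Matrix (Fin 2) (Fin 2) K)).charpoly = (X - C b) * (X - C b) := by
  rw [Matrix.smul_one_eq_diagonal, Matrix.charpoly_diagonal, Fin.prod_univ_two]

/-- **Eigenvalue powers.** If `charpoly A = (X - a)(X - b)` with `a ≠ b` and `A ^ k = c · 1`, then `a ^ k = c`. [folklore] -/
theorem eig_pow_eq {A : Matrix (Fin 2) (Fin 2) K} {a b c : K} (h : A.charpoly = (X - C a) * (X - C b))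
    (hab : a ≠ b) {k : ℕ} (hk : A ^ k = c • (1 : Matrix (Fin 2) (Fin 2) K)) : a ^ k = c := by
  have h1 := pow_mul_sub_smul_eq_smul h k
  rw [hk, smul_mul_assoc, one_mul] at h1
  have h2 : (a ^ k - c) • (A - b • (1 : Matrix (Fin 2) (Fin 2) K)) = 0 := by
    rw [sub_smul, ← h1, sub_self]
  rcases smul_eq_zero.1 h2 with h3 | h3
  · exact sub_eq_zero.1 h3
  · exfalso
    have hA : A = b • (1 : Matrix (Fin 2) (Fin 2) K) := sub_eq_zero.1 h3
    have hch : (X - C a) * (X - C b) = (X - C b) * (X - C b) := by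
      rw [← h, hA, charpoly_smul_one_fin_two]
    have he := congrArg (Polynomial.eval a) hch
    simp only [eval_mul, eval_sub, eval_X, eval_C, sub_self, zero_mul] at he
    exact hab (sub_eq_zero.1 (mul_self_eq_zero.1 he.symm))

/-- Symmetric version for the second root. [folklore] -/
theorem eig_pow_eq' {A : Matrix (Fin 2) (Fin 2) K} {a b c : K} (h : A.charpoly = (X - C a) * (X - C b))
    (hab : a ≠ b) {k : ℕ} (hk : A ^ k = c • (1 : Matrix (Fin 2) (Fin 2) K)) : b ^ k = c :=
  eig_pow_eq (by rw [h, mul_comm]) hab.symm hk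

end Eigen

section Icosa

variable {X : Type*} [Group X]

/-- A subgroup isomorphic to `A₅` is perfect: `⁅G, G⁆ = G`. [folklore] -/
theorem commutator_eq_self_of_mulEquiv_alternatingGroup (G : Subgroup X)
    (e : G ≃* alternatingGroup (Fin 5)) : ⁅G, G⁆ = G := by
  haveI : IsSimpleGroup (alternatingGroup (Fin 5)) := alternatingGroup.isSimpleGroup (by simp)
  haveI : IsSimpleGroup G := e.isSimpleGroup_congr.2 inferInstance
  have htop : ⁅(⊤ : Subgroup G), (⊤ : Subgroup G)⁆ = ⊤ := by
    rcases (inferInstance : (⁅(⊤ : Subgroup G), (⊤ : Subgroup G)⁆).Normal).eq_bot_or_eq_top with h | h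
    · exfalso
      obtain ⟨x, y, hxy⟩ : ∃ x y : alternatingGroup (Fin 5), x * y ≠ y * x := by
        refine ⟨⟨Equiv.swap 0 1 * Equiv.swap 1 2, Equiv.Perm.mem_alternatingGroup.2 (by simp)⟩,
          ⟨Equiv.swap 0 1 * Equiv.swap 1 3, Equiv.Perm.mem_alternatingGroup.2 (by simp)⟩, fun hxy => ?_⟩
        have hv := congrArg (fun z : alternatingGroup (Fin 5) => (z : Equiv.Perm (Fin 5)) 0) hxy
        simp [Equiv.swap_apply_def] at hv
      apply hxy
      have hle := (Subgroup.commutator_eq_bot_iff_le_centralizer.1 h) (Subgroup.mem_top (e.symm x))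
      have hc : e.symm y * e.symm x = e.symm x * e.symm y :=
        (Subgroup.mem_centralizer_iff.1 hle) _ (Subgroup.mem_top _)
      simpa using congrArg e hc.symm
    · exact h
  have hmap : Subgroup.map G.subtype (⊤ : Subgroup G) = G := by
    rw [← MonoidHom.range_eq_map, Subgroup.range_subtype]
  calc ⁅G, G⁆ = Subgroup.map G.subtype ⁅(⊤ : Subgroup G), (⊤ : Subgroup G)⁆ := by
        rw [Subgroup.map_commutator, hmap]
    _ = G := by rw [htop, hmap]

/-- **Images of `A₅`-type are rigid under co-abelian restriction**: if `⁅Γ, Γ⁆ ≤ R` and `f(Γ) ≅ A₅`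
then `f(R) = f(Γ)`. [folklore] -/
theorem map_eq_range_of_commutator_le {Γ : Type*} [Group Γ] (f : Γ →* X) (R : Subgroup Γ)
    (hR : ⁅(⊤ : Subgroup Γ), (⊤ : Subgroup Γ)⁆ ≤ R) (e : f.range ≃* alternatingGroup (Fin 5)) :
    R.map f = f.range := by
  refine le_antisymm (Subgroup.map_le_range f R) ?_
  calc f.range = ⁅f.range, f.range⁆ := (commutator_eq_self_of_mulEquiv_alternatingGroup f.range e).symm
    _ = (⁅(⊤ : Subgroup Γ), (⊤ : Subgroup Γ)⁆).map f := by rw [Subgroup.map_commutator, MonoidHom.range_eq_map]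
    _ ≤ R.map f := Subgroup.map_mono hR

/-- `Nat.card` of a group isomorphic to `A₅` is `60`. [folklore] -/
theorem natCard_eq_sixty_of_mulEquiv_alternatingGroup {P : Type*} [Group P]
    (e : P ≃* alternatingGroup (Fin 5)) : Nat.card P = 60 := by
  rw [Nat.card_congr e.toEquiv, nat_card_alternatingGroup, Nat.card_eq_fintype_card, Fintype.card_fin]
  decide

end Icosa

section Restrict

open Literature.NumberTheory.GaloisRepresentations

/-- **For `M/F` Galois with cyclic (indeed abelian) group, the commutator subgroup of `Γ_F` lies in
`res(Γ_M)`** (`res(Γ_M)` is the kernel of `Γ_F → Gal(M/F)`, `absGaloisQuot_eq_one_iff`). [folklore] -/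
theorem commutator_le_range_absGaloisRestrict (F M : Type*) [Field F] [Field M] [Algebra F M]
    [IsGalois F M] [IsCyclic (M ≃ₐ[F] M)] :
    ⁅(⊤ : Subgroup (Field.absoluteGaloisGroup F)), (⊤ : Subgroup (Field.absoluteGaloisGroup F))⁆ ≤
      (absGaloisRestrict F M).range := by
  obtain ⟨g, hg⟩ := IsCyclic.exists_generator (α := M ≃ₐ[F] M)
  have hcomm : ∀ x y : M ≃ₐ[F] M, x * y = y * x := fun x y => by
    obtain ⟨m, rfl⟩ := Subgroup.mem_zpowers_iff.1 (hg x)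
    obtain ⟨k, rfl⟩ := Subgroup.mem_zpowers_iff.1 (hg y)
    exact (Commute.zpow_zpow_self g m k).eq
  rw [Subgroup.commutator_le]
  intro a _ b _
  rw [← absGaloisQuot_eq_one_iff, map_commutatorElement, commutatorElement_eq_one_iff_mul_comm]
  exact hcomm _ _

end Restrict


/-! ## Transport along a coefficient ring homomorphism (self-contained copies of the folklore lemmas of
`Literature/NumberTheory/GaloisRepresentations/ArtinRepCoefficientTransport`, not imported here) -/

section Transport

open Literature.NumberTheory.GaloisRepresentations NumberField IsDedekindDomain

/-- A group homomorphism out of a topological group with open kernel is continuous. [folklore] -/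
theorem continuous_of_isOpen_ker' {G H : Type*} [Group G] [TopologicalSpace G] [ContinuousMul G]
    [Group H] [TopologicalSpace H] (f : G →* H) (hf : IsOpen (f.ker : Set G)) : Continuous f := by
  refine continuous_def.2 fun U _ => ?_
  have hU : f ⁻¹' U = ⋃ g ∈ f ⁻¹' U, (fun k => g * k) '' (f.ker : Set G) := by
    ext x
    simp only [Set.mem_preimage, Set.mem_iUnion, Set.mem_image, SetLike.mem_coe, MonoidHom.mem_ker,
      exists_prop]
    constructor
    · intro hx; exact ⟨x, hx, 1, map_one f, mul_one x⟩
    · rintro ⟨g, hg, k, hk, rfl⟩; rwa [map_mul, hk, mul_one]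
  rw [hU]
  exact isOpen_biUnion fun g _ => (isOpenMap_mul_left g) _ hf

variable {K : Type} [Field K] {A : Type*} [CommRing A] [TopologicalSpace A]
  {B : Type*} [CommRing B] [TopologicalSpace B] {n : ℕ}

/-- **Change of coefficients for framed representations with open kernel**: `σ ↦ GL_n(φ)(ρ σ)` is again a
framed (continuous) representation. (Deligne–Serre 1974, §8.7.) [folklore] -/
theorem exists_map_of_isOpen_ker' (ρ : FramedGaloisRep K A n)
    (hρ : IsOpen ((ρ : Field.absoluteGaloisGroup K →* GL (Fin n) A).ker : Set (Field.absoluteGaloisGroup K)))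
    (φ : A →+* B) :
    ∃ ρ' : FramedGaloisRep K B n, ∀ σ, ρ' σ = Matrix.GeneralLinearGroup.map φ (ρ σ) := by
  let f : Field.absoluteGaloisGroup K →* GL (Fin n) B :=
    (Matrix.GeneralLinearGroup.map φ).comp (ρ : Field.absoluteGaloisGroup K →* GL (Fin n) A)
  have hle : (ρ : Field.absoluteGaloisGroup K →* GL (Fin n) A).ker ≤ f.ker := fun σ hσ => by
    rw [MonoidHom.mem_ker] at hσ ⊢
    simp only [f, MonoidHom.comp_apply, hσ, map_one]
  have hopen : IsOpen (f.ker : Set (Field.absoluteGaloisGroup K)) := Subgroup.isOpen_mono hle hρ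
  exact ⟨⟨f, continuous_of_isOpen_ker' f hopen⟩, fun σ => rfl⟩

end Transport

end Summit.Langlands.Langlands.Theorems.SplitPrimeDescentLadder.V3Birth.CofinalResidualDoor
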